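import Summits.HodgeConjecture.HodgeConjecture.Theorems.F0P3cStCharTSHeisenbergAnnulusSlice      -- ★ B3 (F0P2-p06): `integral_annulus_heisZ_eq_zero_of_eigen_unit`, `integral_heisHaar_comp_entry`
import Summits.HodgeConjecture.HodgeConjecture.Theorems.F0P3cStCharTSLocalRingNormCompactness    -- ★ DICT (this seat): the B3 binders at `R = LocalRing L v` for `nrm = Π_w |·|_w` (brings FILE 1)
import Summits.HodgeConjecture.HodgeConjecture.Theorems.F0P3cStCharTSPrincipalSeriesUnitary       -- ★ «PS-UNITARY» `norm_apply_eq_one_of_apply_fixed_eq_one` (`|χ₁| = 1` when `χ₁|_{F×} = 1`)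
import HarnessLib

/-!
# F0 · P3c · line LH6 «StCharTS» — «KEYS (3) SHELL VANISHING AT THE CM PLACE★»: for a continuous character `χ₁` of `E_v^×` trivial on `F_v^×` and non-trivial,
# `∫ 𝟙_{A/‖α‖² < nrm z ≤ A} · (nrm z)⁻¹ · χ₁(σ ẑ)⁻¹ d(μ_R ⊗ μ_{R⁻}) = 0` at a non-split `v` — ★ B3 of the road «KEYS3-ANALYTIC» docked on the ★ local-ring norm dictionary
# [Keys1984 §7 Thm. (1); Rogawski1990 §12.2 (3); TateThesis1967 §2.4]

Cell `pub/hodgecm-mathlib`, crux H413 = `stmt-HodgeConjecture-24833` (lane `--supports … --as helper`), route HCCMUnconditional; seat LH6-p04 (g10), twin of the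
ROAD «KEYS3-ANALYTIC» holder F0P2-p06 (g21) (LEAD F0P3a-plan T15-03 (b)); piece D1 (the ANALYTIC end) of the docking B6b of MEMO `F0/P2/F0P2-p06/g21/MEMO-KEYS3-analytic-road.v3`,
taken by DEFAULT §0 2026-09-03T00:37Z.  THEOREMS ONLY (0 def ∕ 0 instance ∕ 0 notation ∕ 0 sorry); ★-only imports.

WHAT.  `R = LocalRing L v = ∏_{w′ ∣ v} L_{w′}`, `σ = conjLocal`, `v` NON-SPLIT (`hw`), `nrm b = Π_{w′} |b_{w′}|_{w′}` (inline), and a continuous `χ₁ : Rˣ →* ℂˣ` with `χ₁|_{(R⁺)ˣ} = 1`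
(`htriv`, Keys' case (3)).  The integrand of the far-out cell function (★ B4 `exists_toFun_weylElt_mul_eq_smul_toFun_one`: `χ₁(σ b)⁻¹ · χ₂(−1) · ‖b‖⁻¹ · f(1)`) is, up to the constant
`χ₂(−1) f(1)`, `(nrm b)⁻¹ · h b` for the EXTENSION BY ZERO `h b := χ₁(σ b̂)⁻¹` (`b` a unit; `0` otherwise), written inline.
* §1 `h` has the four properties ★ B3 asks of it: `dite_chiInvConj_apply_units` (value on units), **`dite_chiInvConj_fixed_units_mul`** (`hhs`: invariance under `σ`-fixed units,
  from `htriv`), **`dite_chiInvConj_units_mul`** (`hb₀`: `h (b₀ b) = χ₁(σ b₀)⁻¹ • h b`), **`exists_units_chiInvConj_ne_one`** (`c = χ₁(σ b₀)⁻¹ ≠ 1` for some unit, from `χ₁ ≠ 1`),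
  **`norm_dite_chiInvConj_le_one`** (`hhb` with `C = 1`: `|χ₁| = 1`, ★ `norm_apply_eq_one_of_apply_fixed_eq_one`), **`measurable_dite_chiInvConj`** (`hhm`: continuous on the open
  set of units — `R` is one local field — and constant off it).
* §2 **`integral_annulus_heisZ_dite_chiInvConj_eq_zero`**: for every additive Haar `μX` of `R`, regular additive Haar `μY` of `R⁻`, every unit `α` with `1 < ‖α‖_R`, every `A > 0`,
  `∫ p, 𝟙_{(A/‖α‖², A]}(nrm z) · ((nrm z)⁻¹ • h z) ∂(μX ⊗ μY) = 0`, `z = heisZ σ p.1 p.2` — ★ B3 `integral_annulus_heisZ_eq_zero_of_eigen_unit` with EVERY structural binder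
  discharged by the ★ dictionary (`hnm hmul hone hnσ`, `δ` ★ `exists_conjLocal_skew_unit`, `hη hunit hunitp hposR hcpt hcptR`, `μp := addHaar` on `R⁺`) and the four `h`-binders by §1;
  **`integral_heisHaar_annulus_dite_chiInvConj_eq_zero`** — the same on `N = (cmBorelTriple L 3 v).N` against ★ `heisHaar` with `z = u₀₂` (★ `integral_heisHaar_comp_entry`).
WHY: this is the analytic end of the docking — with ★ B5 (annulus formula), ★ T2 (Jacobian) and ★ B4 (far-out integrand) it gives `Λ(g₀(m)) = 0` for every torus `m` with
`‖α‖ ≠ 1`, hence `hJf₀` for ★ B6a `secondEigenfunctional_of_one_vector`, hence `hSecond`, hence RUNG 0's outer input `hKeysRed3` by ★ `keysRedThree_of_secondEigenfunctional`.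
HONEST LABEL: HC_CM is proved only modulo the 7 printed citations (2 remaining named inputs: hLiu418 = `stmt-HodgeConjecture-24832`, h413 = `stmt-HodgeConjecture-24833`) until
rung 0 closes; count-neutral helper (no node closes here).

## References
* [Keys1984] D. Keys, *Principal series representations of special unitary groups over local fields*, Compositio Math. 51 (1984), §7 Thm. (1) p. 126.
* [Rogawski1990] J. D. Rogawski, *Automorphic Representations of Unitary Groups in Three Variables*, Ann. of Math. Stud. 123 (1990), §12.2 (3) p. 174.
* [TateThesis1967] J. Tate, *Fourier analysis in number fields and Hecke's zeta-functions*, in Cassels–Fröhlich (1967), §2.4 (a non-trivial character integrates to zero).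
-/

set_option autoImplicit false
-- the mandated namespace has the single-problem summit's repeated segment (`HodgeConjecture.HodgeConjecture`)
set_option linter.dupNamespace false

noncomputable section

open NumberField IsDedekindDomain MeasureTheory Topology Filter
open scoped NNReal ENNReal Pointwise
open Literature.NumberTheory.Automorphic Literature.NumberTheory.Automorphic.UnitaryGroup
open Literature.NumberTheory.GaloisRepresentations Literature.NumberTheory.GaloisRepresentations.IsNonarchimedeanLocalField
open Summit.HodgeConjecture.HodgeConjecture.Cruxes.H413.F0P3cStCharTSLocalRingNormDictionary
open Summit.HodgeConjecture.HodgeConjecture.Cruxes.H413.F0P3cStCharTSLocalRingNormCompactness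
open Summit.HodgeConjecture.HodgeConjecture.Cruxes.H413.F0P3cStCharTSHeisenbergAnnulusSlice

namespace Summit.HodgeConjecture.HodgeConjecture.Cruxes.H413.F0P3cStCharTSKeys3ShellVanishingCM

variable (L : Type) [Field L] [NumberField L] [IsCMField L] (v : HeightOneSpectrum (𝓞 ↥(maximalRealSubfield L)))
  (w : PlacesOver L v) (hw : IsCMField.complexConj L • w.1 = w.1)
  (χ₁ : (LocalRing L v)ˣ →* ℂˣ)

/-! ## §1 The extension by zero `h b = χ₁(σ b̂)⁻¹` and the four binders of ★ B3 -/

open scoped Classical in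
/-- On a unit `u`: `h u = χ₁(σ u)⁻¹`. [cite: Keys1984, §7 Thm. (1) p. 126] -/
theorem dite_chiInvConj_apply_units (u : (LocalRing L v)ˣ) :
    (fun b : LocalRing L v => if hb : IsUnit b then
        (((χ₁ (Units.map (conjLocal L (IsCMField.complexConj L) v : LocalRing L v →* LocalRing L v) hb.unit))⁻¹ : ℂˣ) : ℂ) else 0) (u : LocalRing L v) =
      (((χ₁ (Units.map (conjLocal L (IsCMField.complexConj L) v : LocalRing L v →* LocalRing L v) u))⁻¹ : ℂˣ) : ℂ) := by
  simp only [Units.isUnit, dite_true, IsUnit.unit_of_val_units]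

open scoped Classical in
/-- **`hhs`: `h (s b) = h b` for every `σ`-FIXED unit `s`** (`σ(s b) = s σ b` and `χ₁ s = 1`, `htriv`). [cite: Keys1984, §7 Thm. (1) p. 126] [cite: Rogawski1990, §12.2 (3) p. 174] -/
theorem dite_chiInvConj_fixed_units_mul
    (htriv : ∀ a : (LocalRing L v)ˣ, (conjLocal L (IsCMField.complexConj L) v) (a : LocalRing L v) = a → χ₁ a = 1)
    (s : (LocalRing L v)ˣ) (hs : (conjLocal L (IsCMField.complexConj L) v) (s : LocalRing L v) = s) (b : LocalRing L v) :
    (fun b : LocalRing L v => if hb : IsUnit b then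
        (((χ₁ (Units.map (conjLocal L (IsCMField.complexConj L) v : LocalRing L v →* LocalRing L v) hb.unit))⁻¹ : ℂˣ) : ℂ) else 0) ((s : LocalRing L v) * b) =
      (fun b : LocalRing L v => if hb : IsUnit b then
        (((χ₁ (Units.map (conjLocal L (IsCMField.complexConj L) v : LocalRing L v →* LocalRing L v) hb.unit))⁻¹ : ℂˣ) : ℂ) else 0) b := by
  by_cases hb : IsUnit b
  · have hsb : IsUnit ((s : LocalRing L v) * b) := (Units.isUnit s).mul hb
    have hunit : hsb.unit = s * hb.unit := Units.ext (by rw [IsUnit.unit_spec, Units.val_mul, IsUnit.unit_spec])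
    simp only [hb, hsb, dite_true, hunit, map_mul, mul_inv]
    have hσs : Units.map (conjLocal L (IsCMField.complexConj L) v : LocalRing L v →* LocalRing L v) s = s := Units.ext hs
    rw [hσs, htriv s hs, inv_one, one_mul]
  · have hsb : ¬ IsUnit ((s : LocalRing L v) * b) := fun h => hb ((Units.isUnit_units_mul s b).1 h)
    simp only [hb, hsb, dite_false]

open scoped Classical in
/-- **`hb₀`: `h (b₀ b) = χ₁(σ b₀)⁻¹ • h b`** for every unit `b₀`. [cite: Keys1984, §7 Thm. (1) p. 126] -/
theorem dite_chiInvConj_units_mul (b₀ : (LocalRing L v)ˣ) (b : LocalRing L v) :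
    (fun b : LocalRing L v => if hb : IsUnit b then
        (((χ₁ (Units.map (conjLocal L (IsCMField.complexConj L) v : LocalRing L v →* LocalRing L v) hb.unit))⁻¹ : ℂˣ) : ℂ) else 0) ((b₀ : LocalRing L v) * b) =
      (((χ₁ (Units.map (conjLocal L (IsCMField.complexConj L) v : LocalRing L v →* LocalRing L v) b₀))⁻¹ : ℂˣ) : ℂ) •
        (fun b : LocalRing L v => if hb : IsUnit b then
          (((χ₁ (Units.map (conjLocal L (IsCMField.complexConj L) v : LocalRing L v →* LocalRing L v) hb.unit))⁻¹ : ℂˣ) : ℂ) else 0) b := by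
  by_cases hb : IsUnit b
  · have hsb : IsUnit ((b₀ : LocalRing L v) * b) := (Units.isUnit b₀).mul hb
    have hunit : hsb.unit = b₀ * hb.unit := Units.ext (by rw [IsUnit.unit_spec, Units.val_mul, IsUnit.unit_spec])
    simp only [hb, hsb, dite_true, hunit, map_mul, mul_inv, Units.val_mul, smul_eq_mul]
  · have hsb : ¬ IsUnit ((b₀ : LocalRing L v) * b) := fun h => hb ((Units.isUnit_units_mul b₀ b).1 h)
    simp only [hb, hsb, dite_false, smul_zero]

/-- **`c ≠ 1`**: if `χ₁ ≠ 1` there is a unit `b₀` with `χ₁(σ b₀)⁻¹ ≠ 1` (take `b₀ = σ u` for `χ₁ u ≠ 1`; `σσ = id`). [cite: Keys1984, §7 Thm. (1) p. 126] -/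
theorem exists_units_chiInvConj_ne_one (hne : χ₁ ≠ 1) :
    ∃ b₀ : (LocalRing L v)ˣ, (((χ₁ (Units.map (conjLocal L (IsCMField.complexConj L) v : LocalRing L v →* LocalRing L v) b₀))⁻¹ : ℂˣ) : ℂ) ≠ 1 := by
  obtain ⟨u, hu⟩ : ∃ u : (LocalRing L v)ˣ, χ₁ u ≠ 1 := by
    by_contra h
    push Not at h
    exact hne (MonoidHom.ext fun u => by rw [h u, MonoidHom.one_apply])
  refine ⟨Units.map (conjLocal L (IsCMField.complexConj L) v : LocalRing L v →* LocalRing L v) u, ?_⟩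
  have hσσ : Units.map (conjLocal L (IsCMField.complexConj L) v : LocalRing L v →* LocalRing L v)
      (Units.map (conjLocal L (IsCMField.complexConj L) v : LocalRing L v →* LocalRing L v) u) = u :=
    Units.ext (conjLocal_conjLocal_cm L v _)
  rw [hσσ, Units.val_inv_eq_inv_val, Ne, inv_eq_one, Units.val_eq_one]
  exact hu

open scoped Classical in
/-- **`hhb` with `C = 1`: `‖h b‖ ≤ 1`** — a continuous `χ₁` trivial on the `σ`-fixed units is unitary at a non-split place (★ `norm_apply_eq_one_of_apply_fixed_eq_one`).
[cite: Rogawski1990, §12.2 (3) p. 174] -/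
theorem norm_dite_chiInvConj_le_one (hns : ∀ w' : PlacesOver L v, IsCMField.complexConj L • w'.1 = w'.1)
    (h1 : Continuous fun x => ((χ₁ x : ℂˣ) : ℂ))
    (htriv : ∀ a : (LocalRing L v)ˣ, (conjLocal L (IsCMField.complexConj L) v) (a : LocalRing L v) = a → χ₁ a = 1) (b : LocalRing L v) :
    ‖(fun b : LocalRing L v => if hb : IsUnit b then
        (((χ₁ (Units.map (conjLocal L (IsCMField.complexConj L) v : LocalRing L v →* LocalRing L v) hb.unit))⁻¹ : ℂˣ) : ℂ) else 0) b‖ ≤ 1 := by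
  by_cases hb : IsUnit b
  · simp only [hb, dite_true]
    rw [Units.val_inv_eq_inv_val, norm_inv,
      F0P3cStCharTSPrincipalSeriesUnitary.norm_apply_eq_one_of_apply_fixed_eq_one L v hns χ₁ h1 htriv, inv_one]
  · simp only [hb, dite_false, norm_zero]
    exact zero_le_one

open scoped Classical in
include hw in
/-- **`hhm`: `h` is measurable** — the units of `R` form the open set `{b ≠ 0}` (one place above `v`, ★ `isUnit_iff_ne_zero_localRing`), on which `b ↦ b̂ ∈ Rˣ` is continuous
(Mathlib `Units.continuous_iff`: `b ↦ b` and `b ↦ b⁻¹ = (b_{w′}⁻¹)_{w′}` are continuous there), so `h` is continuous on `{b ≠ 0}` and constant on its complement.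
[cite: WeilBNT1967, Ch. I §2] -/
theorem measurable_dite_chiInvConj [MeasurableSpace (LocalRing L v)] [BorelSpace (LocalRing L v)]
    (h1 : Continuous fun x => ((χ₁ x : ℂˣ) : ℂ)) :
    Measurable (fun b : LocalRing L v => if hb : IsUnit b then
        (((χ₁ (Units.map (conjLocal L (IsCMField.complexConj L) v : LocalRing L v →* LocalRing L v) hb.unit))⁻¹ : ℂˣ) : ℂ) else 0) := by
  haveI : Subsingleton (PlacesOver L v) :=
    PlacesOver.subsingleton_of_smul_eq (IsCMField.complexConj L) (IsCMField.complexConj_ne_one L) w hw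
  set g : LocalRing L v → ℂ := fun b : LocalRing L v => if hb : IsUnit b then
        (((χ₁ (Units.map (conjLocal L (IsCMField.complexConj L) v : LocalRing L v →* LocalRing L v) hb.unit))⁻¹ : ℂˣ) : ℂ) else 0 with hg
  have hU : ∀ b : LocalRing L v, IsUnit b ↔ b ≠ 0 := fun b => isUnit_iff_ne_zero_localRing L v w hw b
  have hσc := continuous_conjLocal L (IsCMField.complexConj L) v
  -- the unit map on the open set `{b ≠ 0}` is continuous
  have hcomp : ∀ (b : {b : LocalRing L v // b ≠ 0}) (w' : PlacesOver L v), (b : LocalRing L v) w' ≠ 0 := by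
    intro b w' h0
    exact b.2 (funext fun w'' => by
      obtain rfl : w'' = w' := Subsingleton.elim w'' w'
      rw [h0, Pi.zero_apply])
  have hF : Continuous (fun b : {b : LocalRing L v // b ≠ 0} => ((hU b).2 b.2).unit) := by
    refine Units.continuous_iff.2 ⟨?_, ?_⟩
    · exact continuous_subtype_val.congr fun b => (((hU b).2 b.2).unit_spec).symm
    · have : (fun b : {b : LocalRing L v // b ≠ 0} => ((((hU b).2 b.2).unit⁻¹ : (LocalRing L v)ˣ) : LocalRing L v)) =
          fun b : {b : LocalRing L v // b ≠ 0} => fun w' => ((b : LocalRing L v) w')⁻¹ := by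
        funext b; funext w'
        have hm : ((((hU b).2 b.2).unit⁻¹ : (LocalRing L v)ˣ) : LocalRing L v) w' * (b : LocalRing L v) w' = 1 := by
          have h1 := congr_fun ((hU b).2 b.2).unit.inv_mul w'
          rw [Pi.mul_apply, IsUnit.unit_spec, Pi.one_apply] at h1
          exact h1
        exact eq_inv_of_mul_eq_one_left hm
      exact (continuous_pi fun w' => ((continuous_apply w').comp continuous_subtype_val).inv₀ fun b => hcomp b w').congr
        fun b => (congr_fun this b).symm
  have hχ : Continuous fun u : (LocalRing L v)ˣ =>
      (((χ₁ (Units.map (conjLocal L (IsCMField.complexConj L) v : LocalRing L v →* LocalRing L v) u))⁻¹ : ℂˣ) : ℂ) := by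
    have hc : Continuous fun u : (LocalRing L v)ˣ =>
        ((χ₁ (Units.map (conjLocal L (IsCMField.complexConj L) v : LocalRing L v →* LocalRing L v) u) : ℂˣ) : ℂ) :=
      h1.comp (Continuous.units_map _ hσc)
    simp_rw [Units.val_inv_eq_inv_val]
    exact hc.inv₀ fun u => Units.ne_zero _
  have hcontU : ContinuousOn g {b : LocalRing L v | b ≠ 0} := by
    rw [continuousOn_iff_continuous_restrict]
    have hres : Set.restrict {b : LocalRing L v | b ≠ 0} g =
        (fun u : (LocalRing L v)ˣ => (((χ₁ (Units.map (conjLocal L (IsCMField.complexConj L) v : LocalRing L v →* LocalRing L v) u))⁻¹ : ℂˣ) : ℂ)) ∘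
          fun b : {b : LocalRing L v // b ≠ 0} => ((hU b).2 b.2).unit := by
      funext b
      simp only [Set.restrict_apply, Function.comp_apply, hg, (hU b).2 b.2, dite_true]
    rw [hres]
    exact hχ.comp hF
  have hcontUc : ContinuousOn g {b : LocalRing L v | b ≠ 0}ᶜ := by
    refine (continuousOn_const (c := (0 : ℂ))).congr fun b hb => ?_
    simp only [Set.mem_compl_iff, Set.mem_setOf_eq, not_not] at hb
    have hnu : ¬ IsUnit b := fun hu => (hU b).1 hu hb
    simp only [hg, hnu, dite_false]
  have hmeas := ContinuousOn.measurable_piecewise hcontU hcontUc (isClosed_singleton.isOpen_compl.measurableSet)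
  rwa [Set.piecewise_same] at hmeas

/-! ## §2 The annulus integral of `(nrm z)⁻¹ χ₁(σ ẑ)⁻¹` vanishes (★ B3 docked on the ★ dictionary) -/

open scoped Classical in
include hw in
set_option maxHeartbeats 800000 in
-- one `exact` of ★ B3 with ~20 discharged binders
/-- **«KEYS (3) SHELL VANISHING AT THE CM PLACE»**: `v` non-split, `χ₁` continuous with `χ₁|_{(R⁺)ˣ} = 1` and `χ₁ ≠ 1`; for every additive Haar measure `μX` of `R`, every regular additive Haar
measure `μY` of `R⁻`, every unit `α` with `1 < ‖α‖_R` and every `A > 0`: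
  `∫ p, 𝟙_{(A/‖α‖², A]}(nrm z) · ((nrm z)⁻¹ • h z) ∂(μX ⊗ μY) = 0`, `z = y − ½ x σx`, `h z = χ₁(σ ẑ)⁻¹` (extension by zero)
— ★ B3 `integral_annulus_heisZ_eq_zero_of_eigen_unit` with the structural binders from ★ `F0P3cStCharTSLocalRingNormDictionary` ∕ `…NormCompactness` and `μp := addHaar`, `δ` ★
`exists_conjLocal_skew_unit`, and the `h`-binders from §1. [cite: Keys1984, §7 Thm. (1) p. 126] [cite: Rogawski1990, §12.2 (3) p. 174] [cite: TateThesis1967, §2.4] -/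
theorem integral_annulus_heisZ_dite_chiInvConj_eq_zero [MeasurableSpace (LocalRing L v)] [BorelSpace (LocalRing L v)] [Invertible (2 : LocalRing L v)]
    (hns : ∀ w' : PlacesOver L v, IsCMField.complexConj L • w'.1 = w'.1)
    (h1 : Continuous fun x => ((χ₁ x : ℂˣ) : ℂ))
    (htriv : ∀ a : (LocalRing L v)ˣ, (conjLocal L (IsCMField.complexConj L) v) (a : LocalRing L v) = a → χ₁ a = 1) (hne : χ₁ ≠ 1)
    (μX : Measure (LocalRing L v)) [μX.IsAddHaarMeasure]
    (μY : Measure ↥(HeisRing.skewPart (conjLocal L (IsCMField.complexConj L) v))) [μY.IsAddHaarMeasure] [μY.Regular]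
    (α : (LocalRing L v)ˣ) (hQ : 1 < distribHaarChar (LocalRing L v) α) {A : ℝ} (hA : 0 < A) :
    ∫ p : LocalRing L v × ↥(HeisRing.skewPart (conjLocal L (IsCMField.complexConj L) v)),
        ((fun b : LocalRing L v => ((∏ w' : PlacesOver L v, normAbs (w'.1.adicCompletion L) (b w') : ℝ≥0) : ℝ)) ⁻¹'
            Set.Ioc (A / ((distribHaarChar (LocalRing L v) α : ℝ) ^ 2)) A).indicator
          (fun b => ((∏ w' : PlacesOver L v, normAbs (w'.1.adicCompletion L) (b w'))⁻¹ : ℝ≥0) •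
            (fun b : LocalRing L v => if hb : IsUnit b then
              (((χ₁ (Units.map (conjLocal L (IsCMField.complexConj L) v : LocalRing L v →* LocalRing L v) hb.unit))⁻¹ : ℂˣ) : ℂ) else 0) b)
          (HeisRing.heisZ (conjLocal L (IsCMField.complexConj L) v) p.1 (p.2 : LocalRing L v)) ∂(μX.prod μY) = 0 := by
  haveI : Subsingleton (PlacesOver L v) :=
    PlacesOver.subsingleton_of_smul_eq (IsCMField.complexConj L) (IsCMField.complexConj_ne_one L) w hw
  haveI : SecondCountableTopology (LocalRing L v) := secondCountableTopology_localRing (E := L) v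
  have hσ := conjLocal_conjLocal_cm L v
  have hσc := continuous_conjLocal L (IsCMField.complexConj L) v
  haveI := HeisRing.locallyCompactSpace_fixedPart (conjLocal L (IsCMField.complexConj L) v) hσc
  obtain ⟨δ, hδ⟩ := exists_conjLocal_skew_unit L v
  obtain ⟨b₀, hb₀⟩ := exists_units_chiInvConj_ne_one L v χ₁ hne
  exact integral_annulus_heisZ_eq_zero_of_eigen_unit (conjLocal L (IsCMField.complexConj L) v) hσ hσc μX μY
    (measurable_prod_normAbs L v) (prod_normAbs_units_mul L v) (prod_normAbs_one L v) (prod_normAbs_conjLocal L v w hw)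
    (Measure.addHaar : Measure ↥(HeisRing.fixedPart (conjLocal L (IsCMField.complexConj L) v))) δ hδ α hQ
    (isUnit_one_add_coe_skewPart L v w hw) (ae_isUnit L v w hw μX) (ae_isUnit_fixedPart L v w hw _) (ae_prod_normAbs_pos L v w hw)
    hA (isCompact_setOf_prod_normAbs_heisZ_le L v w hw A) (isCompact_setOf_prod_normAbs_le L v w hw A)
    _ (measurable_dite_chiInvConj L v w hw χ₁ h1) (norm_dite_chiInvConj_le_one L v χ₁ hns h1 htriv)
    (dite_chiInvConj_fixed_units_mul L v χ₁ htriv) hb₀ (dite_chiInvConj_units_mul L v χ₁ b₀)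

end Summit.HodgeConjecture.HodgeConjecture.Cruxes.H413.F0P3cStCharTSKeys3ShellVanishingCM

end
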